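import Literature.NumberTheory.NumberFields.QuadraticGenusTwoRankExact
import Literature.NumberTheory.IwasawaTheory.ClassNumberPExpLayerOneEqOneOfGenusCertificate
import Literature.NumberTheory.IwasawaTheory.ClassGroupPRankStableOfRankJumpLt
import Literature.NumberTheory.IwasawaTheory.ZpExtensionLayerSuccRamifiedPrimesLe
import Literature.NumberTheory.IwasawaTheory.ClassicalMuVanishesUnitNormIndexAnyPrime
import Literature.NumberTheory.IwasawaTheory.ClassicalMuVanishesLayerOneUnitCertificateTwo
import Literature.NumberTheory.IwasawaTheory.ClassicalMuVanishesLayerTwoUnitCertificateTwo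
import HarnessLib

/-!
# THE CAPITULATION DOOR at the layer `K_2/K_1` of a `ℤ₂`-tower (`p = 2`): if the `2`-part of `Cl(K_1)` capitulates in `K_2` then
# `rank₂ Cl(K_2) + 1 ≤ ord₂ h(K_1) + #{v ∣ 2}`; with `ord₂ h(K_1) = 1` and two dyadic primes `rank₂ Cl(K_2) ≤ 2`, so `μ₂ = 0`, `λ₂ ≤ 2`

Topic `NumberTheory/IwasawaTheory` (namespace = path).  THEOREMS ONLY (no definition, no named fact, no instance, no `sorry`); unconditional.
Written by the prover seat `bsd-line-att-p3` g45 (cell `bsd-f1-sign2`, WIDTH-5 attach on route `AlignedTransportAtTwo`, crux C2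
stmt-BirchSwinnertonDyer-22298; `--supports`, closes nothing).  Sequel of this seat's §4 of `NumberFields/QuadraticGenusTwoRankExact.lean` (Chevalley's
formula read `2`-adically when the `2`-part of the base class group CAPITULATES: `ord₂ [Cl(L):Cl(L)²] + 1 + ord₂ [E_K:E_K ∩ NLˣ] = ord₂ h_K + t`) and of
att-p3 g40's rank-jump door `ClassGroupPRankStableOfRankJumpLt` (`(j,k) = (0,2)`: `rank₂ Cl(K_2) ≤ 2` freezes the ranks, `μ₂ = 0`, `λ₂ ≤ rank₂ Cl(K_2)`).

WHY (cell bsd-f1-sign2, the HARD CORE of the off-stratum sub-cell: complex cubic `K = ℚ(β)`, `2 = 𝔭₁𝔭₂`, `h_K` odd, `ord₂ h(K_1) = 1`, genus regime (β)).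
With `a₀` the class of order two of `Cl(K_1)` (att-p3 g43's odd genus certificate `𝔔 = (x + y√2, α)`): if `a₀` dies in `Cl(K_2)` then the non-trivial element
of `Gal(K_2/K_1)` acts as `−1` on `Cl(K_2)[2^∞]`, every `2`-torsion class of `K_2` is ambiguous for `K_2/K_1`, and Chevalley counts them:
`rank₂ Cl(K_2) ≤ ord₂ h(K_1) + #{ramified} − 1 ≤ 1 + 2 − 1 = 2`.  The certificate is ONE principal generator of `𝔔𝓞_{K_2}` — no unit and no class group of
the degree-12 field `K_2`.  (The seat's census found no seed in this «capitulation» case so far — the landed customer `N = 9139` is in the «aligned» case of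
the layer-two unit door —; this file is the door, typed for the next seeds.)

* `classGroupPRank_two_add_one_le_of_capitulation` — `κ` a `ℤ₂`-extension with Fukuda index `0`, `K_2` a `K_1`-algebra compatibly with `K`, and every class
  of `K_1` of `2`-power order capitulating in `K_2` ⟹ **`rank₂ Cl(K_2) + 1 ≤ ord₂ h(K_1) + #{v : 2 ∈ v}`**.
* ★★ `classicalMuVanishes_two_of_capitulation` — odd degree, `2 ∤ d_K`, `κ` cyclotomic, at most two primes above `2`, `ord₂ h(K_1) ≤ 1`, capitulation ⟹
  `rank₂ Cl(K_m) = rank₂ Cl(K_2) ≤ 2` for all `m ≥ 2`, `μ₂ = 0`, `λ₂ ≤ 2`.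
* ★★ `classicalMuVanishes_two_of_genusCert_odd_of_capitulation` — the same with `ord₂ h(K_1) = 1` AND the capitulation hypothesis discharged from att-p3 g43's
  ODD genus certificate in `𝓞_K` (`x² − 2y² = uα²`, `mα + nx = 1`, `m'α² + 2n' = 1`, `α ≡ ±3 (mod 𝔭₁³)`, units `≡ ±1 (mod 𝔭₁³)`) plus ONE hypothesis:
  the ideal `(x + y s, α)𝓞_{K_2}` is principal (`s ∈ 𝓞_{K_1}`, `s² = 2`).
* ★★★ `classicalMuVanishes_two_of_genusCert_odd_of_capitulationCert` — the same with the principal generator `ξ ∈ 𝓞_K[θ]` (`θ⁴ − 4θ² + 2 = 0`) and its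
  cofactors `a, b, c, e` as TWELVE-coordinate data in `𝓞_K` and three polynomial identities modulo `X⁴ − 4X² + 2` (`x + y(θ²−2) = ξa`, `α = ξb`,
  `ξ = c(x + y(θ²−2)) + eα`): NO element, unit, prime or class group of any layer is an input — the kernel-row form.

HONEST SCOPE: genus theory + the tree's rank-jump door; nothing specific to any summit; no certificate for any field is asserted; BSD is not advanced by this file.

## References

* G. Gras, *Class Field Theory* (2003), IV.4 (genus theory). [Gras2003]
* R. Greenberg, *On the Iwasawa invariants of totally real number fields*, Amer. J. Math. 98 (1976), §4. [Greenberg1976]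
* T. Fukuda, *Remarks on `ℤ_p`-extensions of number fields*, Proc. Japan Acad. 70 A (1994), Thm. 1. [Fukuda1994]
* L. C. Washington, *Introduction to Cyclotomic Fields*, 2nd ed. (1997), §13.1 Prop. 13.2, §13.3 Prop. 13.22–13.23. [Washington1997]
* J. Neukirch, *Algebraic Number Theory* (1999), Ch. III §1 (1.6). [NeukirchANT1999]
-/

set_option autoImplicit false

noncomputable section

open scoped NumberField nonZeroDivisors
open NumberField IsDedekindDomain

namespace Literature.NumberTheory.IwasawaTheory

open Literature.NumberTheory.EllipticCurves Literature.NumberTheory.NumberFields Literature.NumberTheory.NumberFields.AmbiguousClass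
  Literature.NumberTheory.GaloisRepresentations Literature.NumberTheory.GaloisRepresentations.Herbrand
  Literature.NumberTheory.GaloisRepresentations.MinkowskiUnit Literature.NumberTheory.GaloisRepresentations.CyclicNormIndex

/-! ## §1 Two group-theoretic bookkeeping lemmas -/

section Group

variable {G : Type*} [CommGroup G] [Finite G]

/-- `#G[2] = #(G / G²)` for a finite abelian group (kernel and cokernel of squaring have the same order). [folklore] -/
private theorem natCard_ker_powMonoidHom_two_eq :
    Nat.card (powMonoidHom 2 : G →* G).ker = Nat.card (G ⧸ (powMonoidHom 2 : G →* G).range) := by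
  have h1 : Nat.card G = Nat.card (G ⧸ (powMonoidHom 2 : G →* G).ker) * Nat.card (powMonoidHom 2 : G →* G).ker :=
    Subgroup.card_eq_card_quotient_mul_card_subgroup _
  have h2 : Nat.card (G ⧸ (powMonoidHom 2 : G →* G).ker) = Nat.card (powMonoidHom 2 : G →* G).range :=
    Nat.card_congr (QuotientGroup.quotientKerEquivRange (powMonoidHom 2 : G →* G)).toEquiv
  have h3 := (powMonoidHom 2 : G →* G).range.card_mul_index
  rw [Subgroup.index_eq_card] at h3
  rw [h2] at h1
  have hpos : 0 < Nat.card (powMonoidHom 2 : G →* G).range := Nat.card_pos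
  refine Nat.eq_of_mul_eq_mul_left hpos ?_
  rw [h3, h1]

/-- If `#(G/G²) ≤ 2`, `4 ∤ #G`, and `q ≠ 1` with `q² = 1`, then every element of `2`-power order is `1` or `q`; in particular a homomorphism killing `q`
kills every element of `2`-power order. [folklore] -/
private theorem map_eq_one_of_twoPow_orderOf {H : Type*} [Group H]
    (hrank : Nat.card (G ⧸ (powMonoidHom 2 : G →* G).range) ≤ 2) (h4 : ¬ 4 ∣ Nat.card G)
    {q : G} (hq2 : q ^ 2 = 1) (hq1 : q ≠ 1) (f : G →* H) (hf : f q = 1) {d : G} (hd : ∃ k : ℕ, orderOf d = 2 ^ k) :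
    f d = 1 := by
  classical
  obtain ⟨k, hk⟩ := hd
  -- `2^k ∣ #G` and `4 ∤ #G` force `k ≤ 1`
  have hdvd : 2 ^ k ∣ Nat.card G := by rw [← hk]; exact orderOf_dvd_natCard d
  have hk1 : k ≤ 1 := by
    by_contra h
    exact h4 (dvd_trans (pow_dvd_pow 2 (by omega : 2 ≤ k)) hdvd)
  interval_cases k
  · rw [pow_zero, orderOf_eq_one_iff] at hk
    rw [hk, map_one]
  · -- `d` has order `2`: `d, q ∈ G[2]`, a group of order `#(G/G²) ≤ 2`, so `d = q`
    have hd2 : d ^ 2 = 1 := by rw [← pow_one (2 : ℕ), ← hk]; exact pow_orderOf_eq_one d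
    have hd1 : d ≠ 1 := fun h => by rw [h, orderOf_one] at hk; exact absurd hk (by norm_num)
    have hmem : ∀ g : G, g ^ 2 = 1 → g ∈ (powMonoidHom 2 : G →* G).ker := fun g hg => by
      rw [MonoidHom.mem_ker, powMonoidHom_apply]; exact hg
    haveI : Finite (powMonoidHom 2 : G →* G).ker := inferInstance
    have hcard : Nat.card (powMonoidHom 2 : G →* G).ker ≤ 2 := by rw [natCard_ker_powMonoidHom_two_eq]; exact hrank
    -- three pairwise distinct elements `1, d, q` do not fit into `G[2]`
    by_contra hne'
    have hdq : d ≠ q := fun h => hne' (by rw [h, hf])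
    haveI : Fintype (powMonoidHom 2 : G →* G).ker := Fintype.ofFinite _
    have h3 : ({⟨1, one_mem _⟩, ⟨d, hmem d hd2⟩, ⟨q, hmem q hq2⟩} : Finset (powMonoidHom 2 : G →* G).ker).card = 3 := by
      rw [Finset.card_insert_of_notMem, Finset.card_pair]
      · exact fun h => hdq (congrArg Subtype.val h)
      · simp only [Finset.mem_insert, Finset.mem_singleton, not_or]
        exact ⟨fun h => hd1 (congrArg Subtype.val h).symm, fun h => hq1 (congrArg Subtype.val h).symm⟩
    have hle := Finset.card_le_univ ({⟨1, one_mem _⟩, ⟨d, hmem d hd2⟩, ⟨q, hmem q hq2⟩} : Finset (powMonoidHom 2 : G →* G).ker)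
    rw [h3, ← Nat.card_eq_fintype_card] at hle
    omega

end Group

/-! ## §2 The rank bound at the layer `K_2/K_1` -/

section Tower

variable {K : Type} [Field K] [NumberField K] (κ : ZpExtension K 2)

/-- ★ **`rank₂ Cl(K_2) + 1 ≤ ord₂ h(K_1) + #{v : 2 ∈ v}` when the `2`-part of `Cl(K_1)` capitulates in `K_2`.**  `κ` a `ℤ₂`-extension of `K` with Fukuda
index `0` (`TotallyRamifiedFrom κ 0`), `K_2` a `K_1`-algebra compatibly with `K`; if `i_{K_2/K_1} d = 1` for every class `d` of `K_1` of `2`-power order,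
then `rank₂ Cl(K_2) + 1 ≤ ord₂ h(K_1) + #{v ∣ 2 in K}` (`K_2/K_1` is Galois quadratic, unramified at infinity, with at most `#{v ∣ 2}` ramified primes —
tree `ncard_ramified_layer_succ_le` —, so §4 of `QuadraticGenusTwoRankExact` applies and the unit-index term is dropped).
[cite: Gras2003, IV.4] [cite: Washington1997, §13.1 Prop. 13.2] [cite: Greenberg1976, §4] -/
theorem classGroupPRank_two_add_one_le_of_capitulation (hram : TotallyRamifiedFrom κ 0)
    [NumberField (κ.layer 1)] [NumberField (κ.layer 2)] [Algebra (κ.layer 1) (κ.layer 2)] [IsScalarTower K (κ.layer 1) (κ.layer 2)]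
    (hcap : ∀ d : ClassGroup (𝓞 (κ.layer 1)), (∃ k : ℕ, orderOf d = 2 ^ k) →
      classGroupExtend (κ.layer 1) (κ.layer 2) d = 1) :
    classGroupPRank κ 2 + 1 ≤ classNumberPExp κ 1 + {v : HeightOneSpectrum (𝓞 K) | ((2 : ℕ) : 𝓞 K) ∈ v.asIdeal}.ncard := by
  haveI : Fact (Nat.Prime 2) := ⟨Nat.prime_two⟩
  haveI : FiniteDimensional K (κ.layer 1) := κ.finiteDimensional_layer_holds 1
  haveI : FiniteDimensional K (κ.layer 2) := κ.finiteDimensional_layer_holds 2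
  haveI : IsGalois K (κ.layer 2) := κ.isGalois_layer_holds 2
  haveI : IsGalois (κ.layer 1) (κ.layer 2) := IsGalois.tower_top_of_isGalois K _ _
  haveI : FiniteDimensional (κ.layer 1) (κ.layer 2) := Module.Finite.of_restrictScalars_finite K _ _
  haveI : IsUnramifiedAtInfinitePlaces (κ.layer 1) (κ.layer 2) := isUnramifiedAtInfinitePlaces_layer_layer κ 1 2
  have hdeg : Module.finrank (κ.layer 1) (κ.layer 2) = 2 := finrank_layer_one_layer_two κ
  have h := padicValNat_two_index_pow_two_add_eq_ncard_of_capitulation (K := κ.layer 1) (L := κ.layer 2) hdeg hcap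
  have hs : {w : HeightOneSpectrum (𝓞 (κ.layer 1)) | w.asIdeal.ramificationIdxIn (𝓞 (κ.layer 2)) ≠ 1}.ncard ≤
      {v : HeightOneSpectrum (𝓞 K) | ((2 : ℕ) : 𝓞 K) ∈ v.asIdeal}.ncard := ncard_ramified_layer_succ_le κ 1 hram
  rw [classGroupPRank_def, ← Subgroup.index_eq_card, classNumberPExp_eq_padicValNat_classNumber]
  omega

/-- ★★ **THE CAPITULATION DOOR (abstract form): `rank₂ Cl(K_m) = rank₂ Cl(K_2) ≤ 2` for all `m ≥ 2`, `μ₂ = 0`, `λ₂ ≤ 2`.**  `K` of odd degree with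
`2 ∤ d_K` (Fukuda index `0` for every cyclotomic `ℤ₂`-extension), `κ` cyclotomic, at most two primes of `K` above `2`, `ord₂ h(K_1) ≤ 1`, and every class of
`K_1` of `2`-power order capitulating in `K_2` ⟹ `rank₂ Cl(K_2) ≤ 2`, whence the `(0,2)` rank-jump door of att-p3 g40 (`rank₂ Cl(K_2) + 2⁰ < rank₂ Cl(K_0) + 2²`).
[cite: Fukuda1994, Thm. 1 (2), p. 264] [cite: Washington1997, §13.3 Prop. 13.22–13.23] [cite: Gras2003, IV.4] [cite: Greenberg1976, §4] -/
theorem classicalMuVanishes_two_of_capitulation (hK : ¬ 2 ∣ Module.finrank ℚ K) (hd : ¬ (2 : ℤ) ∣ NumberField.discr K)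
    (hκ : κ.IsCyclotomic) [NumberField (κ.layer 1)] [NumberField (κ.layer 2)] [Algebra (κ.layer 1) (κ.layer 2)]
    [IsScalarTower K (κ.layer 1) (κ.layer 2)]
    (h2le : {v : HeightOneSpectrum (𝓞 K) | ((2 : ℕ) : 𝓞 K) ∈ v.asIdeal}.ncard ≤ 2) (he1 : classNumberPExp κ 1 ≤ 1)
    (hcap : ∀ d : ClassGroup (𝓞 (κ.layer 1)), (∃ k : ℕ, orderOf d = 2 ^ k) →
      classGroupExtend (κ.layer 1) (κ.layer 2) d = 1) :
    (∀ m, 2 ≤ m → classGroupPRank κ m = classGroupPRank κ 2) ∧ ClassicalMuVanishes κ ∧ classicalLambda κ ≤ 2 ∧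
      classGroupPRank κ 2 ≤ 2 := by
  haveI : Fact (Nat.Prime 2) := ⟨Nat.prime_two⟩
  have hram : TotallyRamifiedFrom κ 0 := totallyRamifiedFrom_zero_of_not_dvd_discr hK hd κ hκ
  have hle := classGroupPRank_two_add_one_le_of_capitulation κ hram hcap
  have hr2 : classGroupPRank κ 2 ≤ 2 := by omega
  have hjump : classGroupPRank κ (0 + 2) + 2 ^ 0 < classGroupPRank κ (0 + 0) + 2 ^ 2 := by
    simp only [Nat.zero_add, pow_zero]
    omega
  have hmu := classicalMuVanishes_and_classicalLambda_le_of_add_pow_lt_add_pow κ hram le_rfl (j := 0) (k := 2) (Nat.zero_le 2) hjump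
  refine ⟨fun m hm => ?_, hmu.1, hmu.2.trans (by simpa only [Nat.zero_add] using hr2), hr2⟩
  simpa only [Nat.zero_add] using classGroupPRank_eq_of_add_pow_lt_add_pow κ hram le_rfl (j := 0) (k := 2) (Nat.zero_le 2) hjump
    (m := m) (by omega)

/-! ## §3 The door from att-p3 g43's ODD genus certificate plus ONE principal ideal of `K_2` -/

/-- ★★ **THE CAPITULATION DOOR FROM BASE-FIELD DATA.**  `K` of odd degree with `2 ∤ d_K` and `h_K` odd, at most two primes above `2`, `κ` cyclotomic with `K_2`
a `K_1`-algebra compatibly with `K`; `𝔭₁` of norm `2`, every unit `≡ ±1 (mod 𝔭₁³)`; the odd genus certificate `x, y, α, m, n, m', n' ∈ 𝓞_K`, `u ∈ 𝓞_Kˣ` with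
`x² − 2y² = u·α²`, `mα + nx = 1`, `m'α² + 2n' = 1`, `α ≡ ±3 (mod 𝔭₁³)` (so `ord₂ h(K_1) = 1` and `𝔔 = (x + y s, α)`, `s² = 2`, is the non-principal class of order
two); and the CAPITULATION hypothesis: `𝔔𝓞_{K_2}` is principal.  THEN `rank₂ Cl(K_m) = rank₂ Cl(K_2) ≤ 2` for all `m ≥ 2`, `μ₂(κ) = 0`, `λ₂(κ) ≤ 2`.
(`4 ∤ h(K_1)` and `𝔔` non-principal by the tree's `not_isPrincipal_and_not_four_dvd_of_genusCert_of_relNorm_eq`; so the classes of `2`-power order are `1`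
and `[𝔔]`, both dying in `K_2`; then §2.) [cite: Gras2003, IV.4] [cite: Serre1973CourseArithmetic, Ch. III §1.2, Thm. 1] [cite: Fukuda1994, Thm. 1 (2), p. 264]
[cite: Greenberg1976, §4] -/
theorem classicalMuVanishes_two_of_genusCert_odd_of_capitulation (hK : ¬ 2 ∣ Module.finrank ℚ K)
    (hd : ¬ (2 : ℤ) ∣ NumberField.discr K) (hodd : Odd (classNumber K)) (hκ : κ.IsCyclotomic)
    [NumberField (κ.layer 1)] [NumberField (κ.layer 2)] [Algebra (κ.layer 1) (κ.layer 2)] [IsScalarTower K (κ.layer 1) (κ.layer 2)]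
    (h2le : {w : HeightOneSpectrum (𝓞 K) | ((2 : ℕ) : 𝓞 K) ∈ w.asIdeal}.ncard ≤ 2)
    (𝔭₁ : Ideal (𝓞 K)) (hN : Ideal.absNorm 𝔭₁ = 2)
    (hunits : ∀ v : (𝓞 K)ˣ, (v : 𝓞 K) - 1 ∈ 𝔭₁ ^ 3 ∨ (v : 𝓞 K) + 1 ∈ 𝔭₁ ^ 3)
    {x y α m n m' n' : 𝓞 K} {u : (𝓞 K)ˣ} (hxy : x ^ 2 - 2 * y ^ 2 = (u : 𝓞 K) * α ^ 2)
    (hbez : m * α + n * x = 1) (hbez' : m' * α ^ 2 + n' * 2 = 1)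
    (hα : α - 3 ∈ 𝔭₁ ^ 3 ∨ α + 3 ∈ 𝔭₁ ^ 3)
    {s : 𝓞 (κ.layer 1)} (hs : s ^ 2 = 2)
    (hcapQ : ((Ideal.span {algebraMap (𝓞 K) (𝓞 (κ.layer 1)) x + algebraMap (𝓞 K) (𝓞 (κ.layer 1)) y * s,
        algebraMap (𝓞 K) (𝓞 (κ.layer 1)) α}).map (algebraMap (𝓞 (κ.layer 1)) (𝓞 (κ.layer 2)))).IsPrincipal) :
    (∀ m, 2 ≤ m → classGroupPRank κ m = classGroupPRank κ 2) ∧ ClassicalMuVanishes κ ∧ classicalLambda κ ≤ 2 ∧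
      classGroupPRank κ 2 ≤ 2 := by
  classical
  haveI : Fact (Nat.Prime 2) := ⟨Nat.prime_two⟩
  haveI : FiniteDimensional K (κ.layer 1) := κ.finiteDimensional_layer_holds 1
  haveI : IsGalois K (κ.layer 1) := κ.isGalois_layer_holds 1
  have hdeg : Module.finrank K (κ.layer 1) = 2 := by rw [κ.finrank_layer_holds 1, pow_one]
  -- `s = √2 ∉ K`
  have hsK1 : ((s : 𝓞 (κ.layer 1)) : κ.layer 1) ^ 2 = 2 := by
    have := congrArg (fun z : 𝓞 (κ.layer 1) => (z : κ.layer 1)) hs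
    push_cast at this
    exact this
  have hsK : ∀ k : K, algebraMap K (κ.layer 1) k ≠ (s : κ.layer 1) := forall_algebraMap_ne_of_sq_eq_two hd hsK1
  -- the dyadic prime `𝔭₁`
  obtain ⟨h𝔭₁, hP0, h2P, hcard⟩ := isPrime_and_mem_of_absNorm_eq_two 𝔭₁ hN
  haveI := h𝔭₁
  haveI : 𝔭₁.IsMaximal := h𝔭₁.isMaximal hP0
  have hres := forall_mem_or_sub_one_mem_of_card_quotient_eq_two 𝔭₁ hcard
  have h2P' : (2 : 𝓞 K) ∉ 𝔭₁ ^ 2 := two_not_mem_sq_of_not_dvd_discr hd 𝔭₁ h2P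
  -- `rank₂ Cl(K_1) ≤ 1`
  have hgras := classGroupPRank_one_add_one_add_padicValNat_eq_ncard κ hodd
  have ht := ncard_ramified_layer_le_of_ncard_eq κ 1 (s := {w : HeightOneSpectrum (𝓞 K) | ((2 : ℕ) : 𝓞 K) ∈ w.asIdeal}.ncard) rfl
  have hr1 : classGroupPRank κ 1 ≤ 1 := by omega
  have hrank := natCard_quotient_le_two_of_classGroupPRank_le_one κ 1 hr1
  -- the ideal `𝔔 = (δ, α)`, `δ = x + y s`
  set f := algebraMap (𝓞 K) (𝓞 (κ.layer 1)) with hf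
  set δ : 𝓞 (κ.layer 1) := f x + f y * s with hδ
  have hcoe : ∀ z : 𝓞 K, algebraMap (𝓞 (κ.layer 1)) (κ.layer 1) (f z) = algebraMap K (κ.layer 1) (z : K) := fun z => by
    rw [RingOfIntegers.coe_eq_algebraMap, hf]
    exact (IsScalarTower.algebraMap_apply (𝓞 K) (𝓞 (κ.layer 1)) (κ.layer 1) z).symm.trans
      (IsScalarTower.algebraMap_apply (𝓞 K) K (κ.layer 1) z)
  have hcoeδ : (δ : κ.layer 1) = algebraMap K (κ.layer 1) (x : K) + algebraMap K (κ.layer 1) (y : K) * (s : κ.layer 1) := by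
    rw [RingOfIntegers.coe_eq_algebraMap, hδ, map_add, map_mul, hcoe, hcoe]
  have hNδ : Algebra.intNorm (𝓞 K) (𝓞 (κ.layer 1)) δ = (u : 𝓞 K) * α ^ 2 := by
    have h1 : ((Algebra.intNorm (𝓞 K) (𝓞 (κ.layer 1)) δ : 𝓞 K) : K) = Algebra.norm K (δ : κ.layer 1) :=
      Algebra.algebraMap_intNorm (A := 𝓞 K) (K := K) (L := κ.layer 1) (B := 𝓞 (κ.layer 1)) δ
    apply RingOfIntegers.coe_injective
    show ((Algebra.intNorm (𝓞 K) (𝓞 (κ.layer 1)) δ : 𝓞 K) : K) = ((((u : 𝓞 K) * α ^ 2 : 𝓞 K)) : K)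
    rw [h1, hcoeδ, Algebra.norm_add_mul_eq_sq_sub_two_mul_sq hdeg hsK1 hsK, ← hxy]
    push_cast
    simp only [RingOfIntegers.coe_eq_algebraMap, map_ofNat]
  have htr : 2 * f x * δ = δ ^ 2 + f (Algebra.intNorm (𝓞 K) (𝓞 (κ.layer 1)) δ) := by
    rw [hNδ, ← hxy, map_sub, map_mul, map_pow, map_pow, map_ofNat, hδ]
    linear_combination (-(f y) ^ 2) * hs
  obtain ⟨hQ2, hNQ⟩ := sq_span_pair_eq_and_relNorm_eq (K := K) (L := κ.layer 1) hNδ rfl htr hbez hbez'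
  obtain ⟨hQnp, h4⟩ := not_isPrincipal_and_not_four_dvd_of_genusCert_of_relNorm_eq hdeg hsK1 hsK hodd 𝔭₁ hP0 hres h2P h2P'
    hunits hrank hα hNQ ⟨⟨δ, by rw [hQ2, Ideal.submodule_span_eq]⟩⟩
  -- `e₁ = 1`
  have he1 : classNumberPExp κ 1 ≤ 1 :=
    (classNumberPExp_one_eq_one_of_genusCert_odd hK hd hodd κ hκ h2le 𝔭₁ hN hunits hxy hbez hbez' hα).le
  -- the class `q = [𝔔]`: `q ≠ 1`, `q² = 1`, `i(q) = 1`
  set Q : Ideal (𝓞 (κ.layer 1)) := Ideal.span {δ, f α} with hQ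
  have hQ0 : Q ≠ ⊥ := fun h => hQnp (by rw [h]; exact bot_isPrincipal)
  set q : ClassGroup (𝓞 (κ.layer 1)) := ClassGroup.mk0 ⟨Q, mem_nonZeroDivisors_of_ne_zero hQ0⟩ with hq
  have hq1 : q ≠ 1 := fun h => hQnp ((ClassGroup.mk0_eq_one_iff (mem_nonZeroDivisors_of_ne_zero hQ0)).mp h)
  have hq2 : q ^ 2 = 1 := by
    rw [hq, ← map_pow, ClassGroup.mk0_eq_one_iff]
    change ((Q ^ 2 : Ideal (𝓞 (κ.layer 1))) : Submodule _ _).IsPrincipal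
    exact ⟨⟨δ, by rw [hQ2, Ideal.submodule_span_eq]⟩⟩
  have hiq : classGroupExtend (κ.layer 1) (κ.layer 2) q = 1 := by
    rw [hq, classGroupExtend_mk0, ClassGroup.mk0_eq_one_iff]
    exact hcapQ
  have hcardCl : Nat.card (ClassGroup (𝓞 (κ.layer 1))) = classNumber (κ.layer 1) := by
    rw [classNumber, Nat.card_eq_fintype_card]
  have h4' : ¬ 4 ∣ Nat.card (ClassGroup (𝓞 (κ.layer 1))) := h4
  have hcap : ∀ d : ClassGroup (𝓞 (κ.layer 1)), (∃ k : ℕ, orderOf d = 2 ^ k) →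
      classGroupExtend (κ.layer 1) (κ.layer 2) d = 1 := fun d hd' =>
    map_eq_one_of_twoPow_orderOf hrank h4' hq2 hq1 (classGroupExtend (κ.layer 1) (κ.layer 2)) hiq hd'
  exact classicalMuVanishes_two_of_capitulation κ hK hd hκ h2le he1 hcap

/-! ## §4 The door with EVERY datum in `𝓞_K`: the capitulation certificate `x + y(θ² − 2) = ξ·a`, `α = ξ·b`, `ξ = c·(x + y(θ² − 2)) + e·α` in `𝓞_K[θ]` -/

/-- ★★★ **THE CAPITULATION DOOR FROM BASE-FIELD DATA ONLY.**  `K` of odd degree with `2 ∤ d_K` and `h_K` odd, at most two primes above `2`, `κ` cyclotomic;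
`𝔭₁` of norm `2`, every unit `≡ ±1 (mod 𝔭₁³)`; the odd genus certificate `x² − 2y² = u·α²`, `mα + nx = 1`, `m'α² + 2n' = 1`, `α ≡ ±3 (mod 𝔭₁³)`; and the
CAPITULATION CERTIFICATE: `ξ, a, b, c, e ∈ 𝓞_K[θ]` (`θ⁴ − 4θ² + 2 = 0`; four coordinates each in `𝓞_K`) with the three polynomial identities
`x + y(θ² − 2) = ξ·a`, `α = ξ·b`, `ξ = c·(x + y(θ² − 2)) + e·α` at every root `ϑ` of `X⁴ − 4X² + 2` in every `𝓞_K`-algebra (a row proves each by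
`intro S _ _ ϑ hϑ; linear_combination (Q ϑ) * hϑ`).  With `K₂ ∋ θ`, `θ² − 2 = ±√2 ∈ K₁`, they say `(x ± y√2, α)𝓞_{K₂} = (ξ(θ))` — the class of order
two of `Cl(K_1)` capitulates in `K_2` (for either sign, the two ideals being conjugate).  THEN `rank₂ Cl(K_m) = rank₂ Cl(K_2) ≤ 2` for all `m ≥ 2`,
`μ₂(κ) = 0`, `λ₂(κ) ≤ 2`.  No unit, prime or class group of any layer `K_n`, `n ≥ 1`, is an input. [cite: Gras2003, IV.4] [cite: Serre1973CourseArithmetic, Ch. III §1.2, Thm. 1]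
[cite: Fukuda1994, Thm. 1 (2), p. 264] [cite: Greenberg1976, §4] -/
theorem classicalMuVanishes_two_of_genusCert_odd_of_capitulationCert (hK : ¬ 2 ∣ Module.finrank ℚ K)
    (hd : ¬ (2 : ℤ) ∣ NumberField.discr K) (hodd : Odd (classNumber K)) (hκ : κ.IsCyclotomic)
    (h2le : {w : HeightOneSpectrum (𝓞 K) | ((2 : ℕ) : 𝓞 K) ∈ w.asIdeal}.ncard ≤ 2)
    (𝔭₁ : Ideal (𝓞 K)) (hN : Ideal.absNorm 𝔭₁ = 2)
    (hunits : ∀ v : (𝓞 K)ˣ, (v : 𝓞 K) - 1 ∈ 𝔭₁ ^ 3 ∨ (v : 𝓞 K) + 1 ∈ 𝔭₁ ^ 3)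
    {x y α m n m' n' : 𝓞 K} {u : (𝓞 K)ˣ} (hxy : x ^ 2 - 2 * y ^ 2 = (u : 𝓞 K) * α ^ 2)
    (hbez : m * α + n * x = 1) (hbez' : m' * α ^ 2 + n' * 2 = 1)
    (hα : α - 3 ∈ 𝔭₁ ^ 3 ∨ α + 3 ∈ 𝔭₁ ^ 3)
    {ξ₀ ξ₁ ξ₂ ξ₃ a₀ a₁ a₂ a₃ b₀ b₁ b₂ b₃ c₀ c₁ c₂ c₃ e₀ e₁ e₂ e₃ : 𝓞 K}
    (hξa : ∀ (S : Type) [CommRing S] [Algebra (𝓞 K) S] (ϑ : S), ϑ ^ 4 - 4 * ϑ ^ 2 + 2 = 0 →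
      algebraMap (𝓞 K) S x + algebraMap (𝓞 K) S y * (ϑ ^ 2 - 2) =
        (algebraMap (𝓞 K) S ξ₀ + algebraMap (𝓞 K) S ξ₁ * ϑ + algebraMap (𝓞 K) S ξ₂ * ϑ ^ 2 + algebraMap (𝓞 K) S ξ₃ * ϑ ^ 3) *
          (algebraMap (𝓞 K) S a₀ + algebraMap (𝓞 K) S a₁ * ϑ + algebraMap (𝓞 K) S a₂ * ϑ ^ 2 + algebraMap (𝓞 K) S a₃ * ϑ ^ 3))
    (hξb : ∀ (S : Type) [CommRing S] [Algebra (𝓞 K) S] (ϑ : S), ϑ ^ 4 - 4 * ϑ ^ 2 + 2 = 0 →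
      algebraMap (𝓞 K) S α =
        (algebraMap (𝓞 K) S ξ₀ + algebraMap (𝓞 K) S ξ₁ * ϑ + algebraMap (𝓞 K) S ξ₂ * ϑ ^ 2 + algebraMap (𝓞 K) S ξ₃ * ϑ ^ 3) *
          (algebraMap (𝓞 K) S b₀ + algebraMap (𝓞 K) S b₁ * ϑ + algebraMap (𝓞 K) S b₂ * ϑ ^ 2 + algebraMap (𝓞 K) S b₃ * ϑ ^ 3))
    (hξc : ∀ (S : Type) [CommRing S] [Algebra (𝓞 K) S] (ϑ : S), ϑ ^ 4 - 4 * ϑ ^ 2 + 2 = 0 →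
      algebraMap (𝓞 K) S ξ₀ + algebraMap (𝓞 K) S ξ₁ * ϑ + algebraMap (𝓞 K) S ξ₂ * ϑ ^ 2 + algebraMap (𝓞 K) S ξ₃ * ϑ ^ 3 =
        (algebraMap (𝓞 K) S c₀ + algebraMap (𝓞 K) S c₁ * ϑ + algebraMap (𝓞 K) S c₂ * ϑ ^ 2 + algebraMap (𝓞 K) S c₃ * ϑ ^ 3) *
            (algebraMap (𝓞 K) S x + algebraMap (𝓞 K) S y * (ϑ ^ 2 - 2)) +
          (algebraMap (𝓞 K) S e₀ + algebraMap (𝓞 K) S e₁ * ϑ + algebraMap (𝓞 K) S e₂ * ϑ ^ 2 + algebraMap (𝓞 K) S e₃ * ϑ ^ 3) *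
            algebraMap (𝓞 K) S α) :
    (∀ m, 2 ≤ m → classGroupPRank κ m = classGroupPRank κ 2) ∧ ClassicalMuVanishes κ ∧ classicalLambda κ ≤ 2 ∧
      classGroupPRank κ 2 ≤ 2 := by
  classical
  haveI : Fact (Nat.Prime 2) := ⟨Nat.prime_two⟩
  -- the layers `K₁ ⊂ K₂`
  have h12 : κ.layer 1 ≤ κ.layer (1 + 1) := κ.layer_mono (by omega)
  letI : Algebra (κ.layer 1) (κ.layer (1 + 1)) := (IntermediateField.inclusion h12).toRingHom.toAlgebra
  haveI : IsScalarTower K (κ.layer 1) (κ.layer (1 + 1)) :=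
    IsScalarTower.of_algebraMap_eq fun z => ((IntermediateField.inclusion h12).commutes z).symm
  haveI : FiniteDimensional K (κ.layer 1) := κ.finiteDimensional_layer_holds 1
  haveI : FiniteDimensional K (κ.layer (1 + 1)) := κ.finiteDimensional_layer_holds (1 + 1)
  haveI : NumberField (κ.layer 1) := NumberField.of_module_finite K _
  haveI : NumberField (κ.layer (1 + 1)) := NumberField.of_module_finite K _
  -- `s = √2 ∈ K₁`, `t ∈ K₂` with `t² = 2 + s`
  obtain ⟨s, hs, t, ht, -⟩ := exists_sqrt_two_layer_one_sqrt_two_add_layer_two κ hK hκ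
  have hsint : IsIntegral ℤ s := by
    refine ⟨Polynomial.X ^ 2 - Polynomial.C 2, Polynomial.monic_X_pow_sub_C _ two_ne_zero, ?_⟩
    simp [hs]
  set sO : 𝓞 (κ.layer 1) := ⟨s, hsint⟩ with hsO
  have hsO2 : sO ^ 2 = 2 := by
    apply Subtype.ext
    change ((sO ^ 2 : 𝓞 (κ.layer 1)) : κ.layer 1) = ((2 : 𝓞 (κ.layer 1)) : κ.layer 1)
    push_cast
    exact hs
  have ht4 : t ^ 4 - 4 * t ^ 2 + 2 = 0 := by
    have h2 : (t ^ 2 - 2) ^ 2 = 2 := by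
      rw [ht, map_add, map_ofNat, add_sub_cancel_left, ← map_pow, hs, map_ofNat]
    linear_combination h2
  have htit : (fun z : κ.layer (1 + 1) => z ^ 2 - 2)^[2] t = 0 := by
    rw [iterate_sq_sub_two_two]; linear_combination ht4
  set tO : 𝓞 (κ.layer (1 + 1)) := ⟨t, NestedSqrtTwo.isIntegral (R := ℤ) htit⟩ with htO
  have htO4 : tO ^ 4 - 4 * tO ^ 2 + 2 = 0 := by
    apply Subtype.ext
    change ((tO ^ 4 - 4 * tO ^ 2 + 2 : 𝓞 (κ.layer (1 + 1))) : κ.layer (1 + 1)) = ((0 : 𝓞 (κ.layer (1 + 1))) : κ.layer (1 + 1))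
    push_cast
    exact ht4
  -- `g(s) = t² − 2` for `g : 𝓞 K₁ → 𝓞 K₂`
  set g := algebraMap (𝓞 (κ.layer 1)) (𝓞 (κ.layer (1 + 1))) with hg
  set F := algebraMap (𝓞 K) (𝓞 (κ.layer (1 + 1))) with hF
  set f := algebraMap (𝓞 K) (𝓞 (κ.layer 1)) with hf
  have hgs : g sO = tO ^ 2 - 2 := by
    apply Subtype.ext
    change algebraMap (κ.layer 1) (κ.layer (1 + 1)) s = ((tO ^ 2 - 2 : 𝓞 (κ.layer (1 + 1))) : κ.layer (1 + 1))
    push_cast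
    rw [htO]
    change algebraMap (κ.layer 1) (κ.layer (1 + 1)) s = t ^ 2 - 2
    rw [ht, map_add, map_ofNat]; ring
  have hgf : ∀ z : 𝓞 K, g (f z) = F z := fun z => by
    rw [hg, hf, hF, ← IsScalarTower.algebraMap_apply]
  -- the certificate identities in `𝓞 K₂`
  set Ξ : 𝓞 (κ.layer (1 + 1)) := F ξ₀ + F ξ₁ * tO + F ξ₂ * tO ^ 2 + F ξ₃ * tO ^ 3 with hΞ
  have h1 := hξa (𝓞 (κ.layer (1 + 1))) tO htO4
  have h2 := hξb (𝓞 (κ.layer (1 + 1))) tO htO4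
  have h3 := hξc (𝓞 (κ.layer (1 + 1))) tO htO4
  rw [← hF] at h1 h2 h3
  -- `(x + y s, α) 𝓞_{K₂} = (Ξ)`
  have hδ : g (f x + f y * sO) = F x + F y * (tO ^ 2 - 2) := by rw [map_add, map_mul, hgf, hgf, hgs]
  have hcapQ : ((Ideal.span {f x + f y * sO, f α}).map g).IsPrincipal := by
    rw [Ideal.map_span, Set.image_pair, hδ, hgf]
    refine ⟨⟨Ξ, ?_⟩⟩
    rw [Ideal.submodule_span_eq]
    apply le_antisymm
    · rw [Ideal.span_le]
      intro z hz
      simp only [Set.mem_insert_iff, Set.mem_singleton_iff] at hz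
      rcases hz with rfl | rfl
      · exact Ideal.mem_span_singleton.mpr ⟨F a₀ + F a₁ * tO + F a₂ * tO ^ 2 + F a₃ * tO ^ 3, by rw [hΞ]; exact h1⟩
      · exact Ideal.mem_span_singleton.mpr ⟨F b₀ + F b₁ * tO + F b₂ * tO ^ 2 + F b₃ * tO ^ 3, by rw [hΞ]; exact h2⟩
    · rw [Ideal.span_singleton_le_iff_mem, Ideal.mem_span_pair]
      exact ⟨F c₀ + F c₁ * tO + F c₂ * tO ^ 2 + F c₃ * tO ^ 3, F e₀ + F e₁ * tO + F e₂ * tO ^ 2 + F e₃ * tO ^ 3, by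
        rw [hΞ, h3]⟩
  exact classicalMuVanishes_two_of_genusCert_odd_of_capitulation κ hK hd hodd hκ h2le 𝔭₁ hN hunits hxy hbez hbez' hα hsO2 hcapQ

end Tower

end Literature.NumberTheory.IwasawaTheory

end
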